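import Mathlib
import HarnessLib
import Summits.Ventures.LatticeQCDFlow.Scaling.AutoregressiveGaugeHeatBathExact2DOrder

/-!
# LatticeQCDFlow / Scaling — the periodic target from the free-boundary exact sampler: a PERIMETER law
# for the Metropolis acceptance of the one-plaquette heat-bath autoregressive proposal on `(ℤ/L)²`

HONEST FRAMING: exact (Metropolis-corrected) sampling algorithms for lattice gauge theory;
figures of merit are autocorrelation/cost numbers at stated couplings and volumes; no
continuum-physics claim.

Venture `LatticeQCDFlow` (cell pub-lqcd), topic `Scaling`, FANOUT row 30 (lean-1, GEN-23) — OUR WORK on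
THEORY-2.md §4 row C5 (autoregressive context), the periodic companion of
`Scaling/AutoregressiveGaugeHeatBathExact2D{,Order}` (gen-22: on a free-boundary `R × T₀` block `B` of
`(ℤ/L)²` the one-plaquette heat-bath autoregressive model `H_l` is EXACT for the block weight
`F_B = ∏_{p∈B} w(U_p)`, `H_l = F_B/c^{RT₀}` pointwise, acceptance `≡ 1`).  `Scaling/PlaquetteTopLinkOrders`
shows that the same structure cannot be set up for ALL plaquettes of the torus.  Here: it need not be —
used as an INDEPENDENCE PROPOSAL for the PERIODIC target `F = ∏_{p ∈ (ℤ/L)²} w(U_p)` (all `L²`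
plaquettes), the free-boundary exact sampler of the block `B` has Metropolis–Hastings acceptance
`min(1, F(V)H(U)/(F(U)H(V))) = min(1, ∏_{p∉B} w(V_p)/∏_{p∉B} w(U_p)) ≥ (m/M)^{#plaquettes outside B}`
for EVERY current state `U` and EVERY proposal `V`, whenever `0 < m ≤ w ≤ M`.  With the largest block
`R = T₀ = L − 1` only `2L − 1` plaquettes lie outside: ACCEPTANCE `≥ (m/M)^{2L−1}` — a PERIMETER LAW,
uniformly over states, against the AREA-law ceilings `exp(−c·L²)` of endpoint-blind autoregressive
models (`Scaling/AutoregressiveGaugeKLExtensive…`, `…AcceptanceCeiling…`).  For the Wilson weight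
`w(U) = exp((β/N) Re tr U)` one may take `m = e^{−β}`, `M = e^{β}`: acceptance `≥ exp(−2β(2L−1))` at
every coupling, every volume, every state.  (A uniform acceptance floor `a` is a Doeblin minorisation
`P(U, ·) ≥ a·π`; the geometric-ergodicity consequences are not drawn here.)

## What is proved (all [ours])

* **`freeBlock_imhAcceptQ_torus_ge`** — `w` continuous, `0 < m ≤ w ≤ M`; `0 < R`, `R + 1 ≤ L`,
  `T₀ + 1 ≤ L`; `l` a duplicate-free list of all links: for all `U, V`,
  `(m/M)^{#(univ \\ B)} ≤ imhAcceptQ F H_l U V` with `F` the full periodic weight and `H_l` the block's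
  autoregressive heat-bath density.
* **`freeBlock_imhAcceptQ_torus_ge_perimeter`** — `L ≥ 2`, `R = T₀ = L − 1`: the exponent is `2L − 1`.

No `def`, no `sorry`, nothing cited as a fact.
-/

namespace Summit.Ventures.LatticeQCDFlow.Theory2.Autoregressive

open MeasureTheory Function Finset
open Literature.MathematicalPhysics.QuantumFieldTheory Literature.MathematicalPhysics.QuantumLattice
open Summit.Ventures.LatticeQCDFlow.Exactness Summit.Ventures.LatticeQCDFlow.Scoring
open Summit.Ventures.LatticeQCDFlow.Theory2.Lattice Summit.Ventures.LatticeQCDFlow.Theory2.Lattice.TwoDim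

variable {L : ℕ} [NeZero L] {G : Type*} [Group G] [TopologicalSpace G] [IsTopologicalGroup G]
  [CompactSpace G] [SecondCountableTopology G] [MeasurableSpace G] [BorelSpace G]

/-- **Perimeter law for the periodic target.**  `w` continuous with `0 < m ≤ w ≤ M`; `B` the free-boundary
`R × T₀` block at `(i, j)` (`0 < R`, `R + 1 ≤ L`, `T₀ + 1 ≤ L`); `l` a duplicate-free list of ALL links
of `(ℤ/L)²`; `H_l` the block's one-plaquette heat-bath autoregressive density (exact for `F_B`).  As an
independence proposal for the FULL periodic weight `F(U) = ∏_{p} w(U_p)` (all `L²` plaquettes), its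
Metropolis–Hastings acceptance satisfies `(m/M)^{#(plaquettes outside B)} ≤ imhAcceptQ F H_l U V` for
every state `U` and proposal `V`. [ours] -/
theorem freeBlock_imhAcceptQ_torus_ge {w : G → ℝ} (hw : Continuous w) {m M : ℝ} (hm0 : 0 < m)
    (hm : ∀ g, m ≤ w g) (hM : ∀ g, w g ≤ M) (i j : ZMod L)
    {R T₀ : ℕ} (hR0 : 0 < R) (hR : R + 1 ≤ L) (hT₀ : T₀ + 1 ≤ L)
    (l : List (Edge 2 L)) (hl : l.Nodup) (hall : ∀ e : Edge 2 L, e ∈ l) (U V : GaugeConfig 2 L G) :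
    (m / M) ^ (Finset.univ \ (range R ×ˢ range T₀).image
        (fun q : ℕ × ℕ => (![i + q.1, j + q.2] : Site 2 L))).card ≤
      imhAcceptQ
        (fun U : GaugeConfig 2 L G => ∏ p : Site 2 L, w (plaquetteHolonomy U p 0 1))
        (fun U : GaugeConfig 2 L G => (l.map fun b => ∏ p ∈ ((range R ×ˢ range T₀).image
            (fun q : ℕ × ℕ => (![i + q.1, j + q.2] : Site 2 L))).filter
              (fun p' : Site 2 L => ((Site.shift p' 1, (0 : Fin 2)) : Edge 2 L) = b),
            w (plaquetteHolonomy U p 0 1) / (∫ g, w g ∂(haarProbability G))).prod *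
          coordAvg (haarProbability G) l.toFinset
            (fun V : GaugeConfig 2 L G => ∏ p ∈ (range R ×ˢ range T₀).image
              (fun q : ℕ × ℕ => (![i + q.1, j + q.2] : Site 2 L)), w (plaquetteHolonomy V p 0 1)) U /
          (∫ V, ∏ p ∈ (range R ×ˢ range T₀).image (fun q : ℕ × ℕ => (![i + q.1, j + q.2] : Site 2 L)),
            w (plaquetteHolonomy V p 0 1) ∂(Measure.pi fun _ : Edge 2 L => haarProbability G)))
        U V := by
  have hw0 : ∀ g, 0 < w g := fun g => lt_of_lt_of_le hm0 (hm g)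
  unfold imhAcceptQ
  beta_reduce
  rw [freeBlock_arHybrid_eq_target (G := G) hw hw0 i j hR0 hR hT₀ l hl hall U,
    freeBlock_arHybrid_eq_target (G := G) hw hw0 i j hR0 hR hT₀ l hl hall V]
  have hc : 0 < ∫ g, w g ∂(haarProbability G) := haarProbability_integral_pos_of_continuous_pos hw hw0
  have hZ : 0 < ∫ V, ∏ p ∈ (range R ×ˢ range T₀).image (fun q : ℕ × ℕ => (![i + q.1, j + q.2] : Site 2 L)),
      w (plaquetteHolonomy V p 0 1) ∂(Measure.pi fun _ : Edge 2 L => haarProbability G) := by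
    rw [freeBlock_integral_prod_eq_pow (G := G) hw i j hR0 hR hT₀]; exact pow_pos hc _
  set B : Finset (Site 2 L) := (range R ×ˢ range T₀).image
    (fun q : ℕ × ℕ => (![i + q.1, j + q.2] : Site 2 L)) with hB
  set Z : ℝ := ∫ V, ∏ p ∈ B, w (plaquetteHolonomy V p 0 1)
    ∂(Measure.pi fun _ : Edge 2 L => haarProbability G) with hZdef
  set FB : GaugeConfig 2 L G → ℝ := fun U => ∏ p ∈ B, w (plaquetteHolonomy U p 0 1) with hFB
  set FR : GaugeConfig 2 L G → ℝ := fun U => ∏ p ∈ Finset.univ \ B, w (plaquetteHolonomy U p 0 1)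
    with hFR
  have hsplit : ∀ W : GaugeConfig 2 L G, ∏ p : Site 2 L, w (plaquetteHolonomy W p 0 1) = FR W * FB W :=
    fun W => (Finset.prod_sdiff (Finset.subset_univ B)).symm
  have hFBpos : ∀ W, 0 < FB W := fun W => prod_pos fun p _ => hw0 _
  have hFRpos : ∀ W, 0 < FR W := fun W => prod_pos fun p _ => hw0 _
  have hMpos : 0 < M := lt_of_lt_of_le (hw0 1) (hM 1)
  have hFBU : FB U ≠ 0 := (hFBpos U).ne'
  have hFBV : FB V ≠ 0 := (hFBpos V).ne'
  have hFRU : FR U ≠ 0 := (hFRpos U).ne'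
  have hZne : Z ≠ 0 := hZ.ne'
  -- the ratio collapses to `FR V / FR U`
  have hratio : (FR V * FB V) * (FB U / Z) / ((FR U * FB U) * (FB V / Z)) = FR V / FR U := by
    field_simp
  rw [hsplit U, hsplit V]
  change (m / M) ^ (Finset.univ \ B).card ≤ min 1 ((FR V * FB V) * (FB U / Z) / ((FR U * FB U) * (FB V / Z)))
  rw [hratio]
  -- `(m/M)^k ≤ 1` and `(m/M)^k ≤ FR V / FR U`
  have hmM : m / M ≤ 1 := (div_le_one hMpos).2 ((hm 1).trans (hM 1))
  have hmM0 : 0 ≤ m / M := div_nonneg hm0.le hMpos.le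
  refine le_min (pow_le_one₀ hmM0 hmM) ?_
  have hlow : m ^ (Finset.univ \ B).card ≤ FR V := by
    rw [hFR, ← Finset.prod_const]
    exact Finset.prod_le_prod (fun p _ => hm0.le) fun p _ => hm _
  have hup : FR U ≤ M ^ (Finset.univ \ B).card := by
    rw [hFR, ← Finset.prod_const]
    exact Finset.prod_le_prod (fun p _ => (hw0 _).le) fun p _ => hM _
  rw [div_pow, div_le_div_iff₀ (pow_pos hMpos _) (hFRpos U)]
  calc m ^ (Finset.univ \ B).card * FR U ≤ FR V * M ^ (Finset.univ \ B).card := by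
        have := mul_le_mul hlow hup (hFRpos U).le (hFRpos V).le
        linarith [this]
    _ = FR V * M ^ (Finset.univ \ B).card := rfl

omit [TopologicalSpace G] [IsTopologicalGroup G] [CompactSpace G] [SecondCountableTopology G]
  [MeasurableSpace G] [BorelSpace G] in
/-- **The perimeter count**: for `L ≥ 2` exactly `2L − 1` plaquettes of `(ℤ/L)²` lie outside the
`(L−1) × (L−1)` block. [ours] -/
theorem card_univ_sdiff_maxBlock (hL : 2 ≤ L) (i j : ZMod L) :
    (Finset.univ \ (range (L - 1) ×ˢ range (L - 1)).image
      (fun q : ℕ × ℕ => (![i + q.1, j + q.2] : Site 2 L))).card = 2 * L - 1 := by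
  rw [Finset.card_univ_sdiff, card_rectSites i j (by omega : L - 1 ≤ L) (by omega : L - 1 ≤ L)]
  have hS : Fintype.card (Site 2 L) = L ^ 2 := by
    simp [Fintype.card_pi, ZMod.card, Finset.prod_const, Finset.card_univ, Fintype.card_fin]
  rw [hS]
  obtain ⟨k, rfl⟩ : ∃ k, L = k + 1 := ⟨L - 1, by omega⟩
  have hsq : (k + 1) ^ 2 = k ^ 2 + (2 * k + 1) := by ring
  rw [Nat.add_sub_cancel, hsq, ← pow_two]
  generalize k ^ 2 = K
  omega

/-- **The perimeter exponent.**  For `L ≥ 2` and the largest block `R = T₀ = L − 1` exactly `2L − 1`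
plaquettes of the torus lie outside the block, so the acceptance floor of
`freeBlock_imhAcceptQ_torus_ge` is `(m/M)^{2L−1}`: uniformly over states and proposals, the periodic
Wilson-type target is reached from the free-boundary exact sampler at a cost exponential in the
PERIMETER only. [ours] -/
theorem freeBlock_imhAcceptQ_torus_ge_perimeter (hL : 2 ≤ L) {w : G → ℝ} (hw : Continuous w) {m M : ℝ}
    (hm0 : 0 < m) (hm : ∀ g, m ≤ w g) (hM : ∀ g, w g ≤ M) (i j : ZMod L)
    (l : List (Edge 2 L)) (hl : l.Nodup) (hall : ∀ e : Edge 2 L, e ∈ l) (U V : GaugeConfig 2 L G) :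
    (m / M) ^ (2 * L - 1) ≤
      imhAcceptQ
        (fun U : GaugeConfig 2 L G => ∏ p : Site 2 L, w (plaquetteHolonomy U p 0 1))
        (fun U : GaugeConfig 2 L G => (l.map fun b => ∏ p ∈ ((range (L - 1) ×ˢ range (L - 1)).image
            (fun q : ℕ × ℕ => (![i + q.1, j + q.2] : Site 2 L))).filter
              (fun p' : Site 2 L => ((Site.shift p' 1, (0 : Fin 2)) : Edge 2 L) = b),
            w (plaquetteHolonomy U p 0 1) / (∫ g, w g ∂(haarProbability G))).prod *
          coordAvg (haarProbability G) l.toFinset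
            (fun V : GaugeConfig 2 L G => ∏ p ∈ (range (L - 1) ×ˢ range (L - 1)).image
              (fun q : ℕ × ℕ => (![i + q.1, j + q.2] : Site 2 L)), w (plaquetteHolonomy V p 0 1)) U /
          (∫ V, ∏ p ∈ (range (L - 1) ×ˢ range (L - 1)).image
              (fun q : ℕ × ℕ => (![i + q.1, j + q.2] : Site 2 L)),
            w (plaquetteHolonomy V p 0 1) ∂(Measure.pi fun _ : Edge 2 L => haarProbability G)))
        U V := by
  have hR0 : 0 < L - 1 := by omega
  have hR : L - 1 + 1 ≤ L := by omega
  have h := freeBlock_imhAcceptQ_torus_ge (G := G) hw hm0 hm hM i j hR0 hR hR l hl hall U V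
  have hcard := card_univ_sdiff_maxBlock (L := L) hL i j
  rw [hcard] at h
  exact h

end Summit.Ventures.LatticeQCDFlow.Theory2.Autoregressive
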